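import Literature.ComputerArithmetic.Shewchuk1997.Compress
import Literature.ComputerArithmetic.BoldoJeannerodMelquiondMuller2023.ExactAddition
import Literature.ComputerArithmetic.BoldoJeannerodMelquiondMuller2023.DirectedRoundings
import Mathlib.Tactic.Linarith
import Mathlib.Tactic.Positivity
import Mathlib.Tactic.Ring
import Mathlib.Tactic.NormNum

/-!
# The largest component of COMPRESS(e) is a faithful rounding of Σ e

NEW WORK in the sense of this development (the routine is Shewchuk's COMPRESS, §2.7 of
[Shewchuk1997]; the theorem and its proof are ours).  Theorem 23 (`compress_spec`) says that the
largest component `hₙ` of `h = COMPRESS(e)` "approximates `h` with an error smaller than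
`ulp(hₙ)`".  THIS FILE proves the sharper statement that `hₙ` is a FAITHFUL ROUNDING of the exact
sum: `hₙ ∈ {RD(Σ e), RU(Σ e)}` — for every precision `p ≥ 2`, EVERY round-to-nearest `fl` (no
tie rule needed) and every nonoverlapping input expansion of floats (gradual underflow included):
* `compress_top_isFaithful` — `IsFaithful p emin e.sum L` for the last component `L` of
  `compress fl e`;
* `abs_compress_top_sub_sum_lt_ulp` — hence `|L − Σ e| < ulp (Σ e)` (which can be half of
  Theorem 23's `ulp L`), and `compress_top_eq_sum` — `L = Σ e` whenever `Σ e` is a float;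
* `compress_eq_singleton_of_isFloat_sum` — consequently COMPRESS returns the ONE-component
  expansion `[Σ e]` whenever the sum is representable (Theorem 23's no-zero clause does the rest).
So after COMPRESS no APPROXIMATE pass is needed: reading off the top component already gives a
faithfully rounded value (exact sign, `= 0` exactly when `Σ e = 0`, never a float strictly between
it and `Σ e`).  Faithful is the right word: `hₙ` need not be the NEAREST float (`p = 4`,
ties-to-even: `e = ⟨−1, 2, −16, −288⟩ ↦ h = ⟨1, 16, −320⟩`, `Σ e = −303`, nearest `−288`).

PROOF (ours).  Follow the second (smallest-first) traversal of COMPRESS with the invariant "the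
carry `Q` is a faithful rounding of `Q + Σ(emitted components)`".  One step replaces `Q` by
`Qₙ = fl (g + Q)` and possibly emits the roundoff `q = g + Q − Qₙ`, where `g` is the next component
of the first traversal: a float `≥ 2^(emin+p)` with `|Q| ≤ ulp g`, while the emitted part `r`
satisfies `|r| < ulp Q` (Theorem 23's invariant) and `|Q + r| < ulp g` (the "stair" left by the
first traversal).  Everything in sight — `Q`, `g`, `g + Q`, and `Qₙ` (as `|Qₙ| ≥ |Q|`) — lies on
the grid `ulp(Q)·ℤ`.  If `q ≠ 0` then `|q| ≥ ulp Q > |r|`, and since `Qₙ` is a nearest float to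
`g + Q` no float other than `Qₙ` lies in the closed segment from `Qₙ` to `g + Q + r`.  If `q = 0`, a
float `F ≠ Qₙ` in that segment is within `|r| < ulp Q` of `Qₙ` and within `ulp g ≤ |g|/2` of `g`,
so `|F| ≥ |Q|`, `F` lies on the grid too, and `|F − Qₙ| ≥ ulp Q` — impossible.  Either way `Qₙ`
is a faithful rounding of `Qₙ + q + r`, and at the end the carry is the top component.

Evidence gathered before the proof (exhaustive over nonoverlapping inputs with `p`-bit components
below `2^E`, signs free; top component compared with `RD/RU` of the exact sum): `p = 2`
(`E = 11`, length `≤ 6`, 393 974 inputs) under ties-to-even / ties-away / ties-to-zero /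
ties-to-odd, `p = 3` (`E = 11`, length `≤ 5`, 483 546 inputs) under ties-to-even / ties-away,
`p = 4` (`E = 12`, length `≤ 4`, 628 970 inputs) under ties-to-even / ties-to-odd: no unfaithful
top component; faithful-but-not-nearest tops in 1–13 % of the inputs; largest `|Σ e − L|/ulp L`
observed `341/512`, `73/128`, `17/32`.  Reference: J. R. Shewchuk, Discrete Comput. Geom. 18 (1997)
305–363, §2.7–2.8, Theorem 23 [Shewchuk1997]; faithful rounding as in Boldo–Jeannerod–
Melquiond–Muller, ACM Comput. Surv. 55 (2023), §2.2.  Nearest formal prior art: Boldo–Joldes–Muller–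
Popescu (ITP 2017, LNCS 10499) verify in Coq that CAMPARY's renormalisation returns an
ulp-nonoverlapping expansion — a different routine, with no statement about the leading term
being a faithful rounding; neither is one made in [Shewchuk1997].
-/

namespace Summit.Ventures.CertifiedArithmetic.Expansions

open Literature.ComputerArithmetic.JeannerodRump2018
open Literature.ComputerArithmetic.BoldoJeannerodMelquiondMuller2023 hiding twoSum twoSum_fst
open Literature.ComputerArithmetic.Shewchuk1997

variable {p : ℕ} {emin : ℤ} {fl : ℚ → ℚ}

/-- A float `A` is a faithful rounding of `S` as soon as `A` is the only float of the closed
segment between `A` and `S`. -/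
private theorem isFaithful_of_forall_eq {S A : ℚ} (hA : IsFloat p emin A)
    (h : ∀ F : ℚ, IsFloat p emin F → min A S ≤ F → F ≤ max A S → F = A) :
    IsFaithful p emin S A := by
  rcases le_total A S with hAS | hSA
  · refine Or.inl ⟨hA, hAS, fun f hf hfS => not_lt.mp fun hAf => ?_⟩
    have := h f hf (by rw [min_eq_left hAS]; exact hAf.le) (by rw [max_eq_right hAS]; exact hfS)
    exact absurd this (ne_of_gt hAf)
  · refine Or.inr ⟨hA, hSA, fun f hf hSf => not_lt.mp fun hfA => ?_⟩
    have := h f hf (by rw [min_eq_right hSA]; exact hSf) (by rw [max_eq_left hSA]; exact hfA.le)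
    exact absurd this (ne_of_lt hfA)

/-- A float at least `2^(emin+p)` in magnitude is at least twice its ulp (`p ≥ 2`). -/
private theorem two_mul_ulp_le_abs (hp : 2 ≤ p) {g : ℚ} (hgbig : (2 : ℚ) ^ (emin + p) ≤ |g|) :
    2 * ulp p emin g ≤ |g| := by
  have hpos : 0 < |g| := lt_of_lt_of_le (zpow_pos (by norm_num) _) hgbig
  have hg0 : g ≠ 0 := abs_pos.mp hpos
  rw [ulp_of_ne_zero hg0]
  have hlog : emin + p ≤ Int.log 2 |g| :=
    (Int.zpow_le_iff_le_log (b := 2) (by norm_num) hpos).mp (by exact_mod_cast hgbig)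
  have hmax : max emin (Int.log 2 |g| - p + 1) + 1 ≤ Int.log 2 |g| := by
    have : (2 : ℤ) ≤ p := by exact_mod_cast hp
    omega
  calc 2 * (2 : ℚ) ^ max emin (Int.log 2 |g| - p + 1)
      = (2 : ℚ) ^ (max emin (Int.log 2 |g| - p + 1) + 1) := by
        rw [zpow_add_one₀ (by norm_num : (2 : ℚ) ≠ 0), mul_comm]
    _ ≤ (2 : ℚ) ^ Int.log 2 |g| := zpow_le_zpow_right₀ (by norm_num) hmax
    _ ≤ |g| := zpow_log_le_abs hg0

/-- The order argument of the emitting case: `A = T − d` is a nearest float to `T`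
(`|d| ≤ |T − F|`), the perturbation `r` of `T` is smaller than `|d|`, and then no float `F ≠ A`
lies in the closed segment from `A` to `T + r`. -/
private theorem seg_contra {T A F r d : ℚ} (hA : A = T - d) (hdr : |r| < |d|)
    (hnear : |d| ≤ |T - F|) (hseg : (A ≤ F ∧ F ≤ T + r) ∨ (T + r ≤ F ∧ F ≤ A)) (hne : F ≠ A) :
    False := by
  have hr1 := le_abs_self r
  have hr2 := neg_abs_le r
  rcases hseg with ⟨h1, h2⟩ | ⟨h1, h2⟩ <;> rcases lt_or_gt_of_ne hne with h3 | h3 <;>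
    rcases abs_cases d with ⟨hd, _⟩ | ⟨hd, _⟩ <;>
    rcases abs_cases (T - F) with ⟨ht, _⟩ | ⟨ht, _⟩ <;> linarith

/-- ONE STEP OF THE SECOND TRAVERSAL.  Carry `Q` (a float), emitted part `r` with `|r| < ulp Q`,
next component `g` (a float `≥ 2^(emin+p)` with `|Q| ≤ ulp g`) and the stair `|Q + r| < ulp g`:
then `fl (g + Q)` is a faithful rounding of `g + Q + r`. -/
private theorem step_faithful (hp : 2 ≤ p) (hfl : IsRoundNearest p emin fl) {Q g r : ℚ}
    (hQ : IsFloat p emin Q) (hgbig : (2 : ℚ) ^ (emin + p) ≤ |g|) (hg : IsFloat p emin g)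
    (hQg : |Q| ≤ ulp p emin g) (hr : |r| < ulp p emin Q) (hst : |Q + r| < ulp p emin g) :
    IsFaithful p emin (g + Q + r) (fl (g + Q)) := by
  set T := g + Q with hT
  have hA : IsFloat p emin (fl T) := (hfl T).1
  have h2u : 2 * ulp p emin g ≤ |g| := two_mul_ulp_le_abs hp hgbig
  have hgT : |g| ≤ |T| + |Q| := by
    have h := abs_add_le (g + Q) (-Q)
    rwa [abs_neg, add_neg_cancel_right] at h
  have hQT : |Q| ≤ |T| := by linarith
  -- `Q`, `g`, `T` and `fl T` lie on the grid `2^k = ulp Q`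
  obtain ⟨k, -, hk⟩ := exists_ulp_eq_two_zpow (p := p) (emin := emin) Q
  have hkQ : OnGrid k Q := by
    obtain ⟨K, hK⟩ := exists_eq_int_mul_ulp_of_isFloat (p := p) (emin := emin) hQ
    exact ⟨K, by rw [← hk]; exact hK⟩
  have hQleg : |Q| ≤ |g| := by linarith [ulp_pos (p := p) (emin := emin) g]
  have hkg : OnGrid k g := onGrid_of_two_zpow_le_ulp hg (by rw [← hk]; exact ulp_mono hQleg)
  have hkT : OnGrid k T := hkg.add hkQ
  have hkA : OnGrid k (fl T) :=
    onGrid_of_two_zpow_le_ulp hA (by rw [← hk]; exact ulp_mono (abs_le_abs_fl hfl hQ hQT))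
  rw [hk] at hr
  refine isFaithful_of_forall_eq hA fun F hF hF1 hF2 => ?_
  by_contra hne
  have hseg : (fl T ≤ F ∧ F ≤ T + r) ∨ (T + r ≤ F ∧ F ≤ fl T) := by
    rcases le_total (fl T) (T + r) with h | h
    · rw [min_eq_left h] at hF1; rw [max_eq_right h] at hF2; exact Or.inl ⟨hF1, hF2⟩
    · rw [min_eq_right h] at hF1; rw [max_eq_left h] at hF2; exact Or.inr ⟨hF1, hF2⟩
  have hnear : |T - fl T| ≤ |T - F| := (hfl T).2 F hF
  by_cases hq : fl T = T
  · -- exact step: `F` and `T` lie on the grid and are closer than `2^k`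
    rw [hq] at hseg hne
    have hQ1 := abs_le.mp hQg
    have hst1 := abs_lt.mp hst
    have hFg : |F - g| ≤ ulp p emin g := by
      rw [abs_le]; rcases hseg with ⟨h1, h2⟩ | ⟨h1, h2⟩ <;> constructor <;> linarith
    have hgF : |g| - |F| ≤ |F - g| := by
      rw [abs_sub_comm]; exact abs_sub_abs_le_abs_sub g F
    have hQF : |Q| ≤ |F| := by linarith
    have hkF : OnGrid k F :=
      onGrid_of_two_zpow_le_ulp hF (by rw [← hk]; exact ulp_mono hQF)
    have hFT : |F - T| ≤ |r| := by
      rcases hseg with ⟨h1, h2⟩ | ⟨h1, h2⟩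
      · rw [abs_of_nonneg (by linarith)]; linarith [le_abs_self r]
      · rw [abs_of_nonpos (by linarith)]; linarith [neg_le_abs r]
    have h2k : (2 : ℚ) ^ k ≤ |F - T| := (hkF.sub hkT).two_zpow_le_abs (sub_ne_zero.mpr hne)
    linarith
  · -- emitting step: the roundoff is at least `2^k > |r|`, and `fl T` is nearest to `T`
    have hd : (2 : ℚ) ^ k ≤ |T - fl T| :=
      (hkT.sub hkA).two_zpow_le_abs (sub_ne_zero.mpr (Ne.symm hq))
    exact seg_contra (d := T - fl T) (by ring) (lt_of_lt_of_le hr hd) hnear hseg hne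

/-- The second traversal never returns the empty list. -/
private theorem compressUp_ne_nil (fl : ℚ → ℚ) :
    ∀ (gs : List ℚ) (Q : ℚ), compressUp fl Q gs ≠ [] := by
  intro gs
  induction gs with
  | nil => intro Q; simp
  | cons g rest ih =>
    intro Q
    by_cases hq : (fastTwoSum fl g Q).2 = 0
    · rw [compressUp_cons_of_eq_zero hq]; exact ih _
    · rw [compressUp_cons_of_ne_zero hq]; exact List.cons_ne_nil _ _

/-- Consing in front does not change the last element of a nonempty list. -/
private theorem getLast?_cons_of_ne_nil {a : ℚ} {l : List ℚ} (h : l ≠ []) :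
    (a :: l).getLast? = l.getLast? := by
  obtain ⟨b, l', rfl⟩ := List.exists_cons_of_ne_nil h
  exact List.getLast?_cons_cons

/-- THE SECOND TRAVERSAL (Lines 10–16 of COMPRESS) run from a state satisfying Theorem 23's
invariant `UpInv` whose carry is a faithful rounding of "carry + emitted part", over remaining
components obeying the hypotheses of `compressUp_spec`, ends with a top component that is a
faithful rounding of the exact total. -/
private theorem compressUp_top_isFaithful (hp : 2 ≤ p) (hfl : IsRoundNearest p emin fl) {c : ℚ}
    (hc : 1 ≤ c) (hflc : RoundoffBelow c fl) :
    ∀ (gs : List ℚ) (Q : ℚ) (rs : List ℚ), UpInv p emin c rs Q →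
      IsFaithful p emin (Q + rs.sum) Q →
      (∀ g ∈ gs, IsFloat p emin g) → (∀ g ∈ gs, (2 : ℚ) ^ (emin + p) ≤ |g|) →
      UStair p emin (Q + rs.sum) gs → gs.IsChain (fun a b => |a| ≤ ulp p emin b) →
      (∀ g ∈ gs.head?, |Q| ≤ ulp p emin g) →
      ∀ L ∈ (compressUp fl Q gs).getLast?, IsFaithful p emin (Q + rs.sum + gs.sum) L := by
  have hp1 : 1 ≤ p := le_trans (by norm_num) hp
  intro gs
  induction gs with
  | nil =>
    intro Q rs _ hJ _ _ _ _ _ L hL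
    have hLQ : L = Q := by simpa using hL.symm
    rw [hLQ, List.sum_nil, add_zero]; exact hJ
  | cons g rest ih =>
    intro Q rs inv _ hF hbig hst hch hQg L hL
    have hg : IsFloat p emin g := hF g (by simp)
    have hgbig : (2 : ℚ) ^ (emin + p) ≤ |g| := hbig g (by simp)
    have hQg' : |Q| ≤ ulp p emin g := hQg g (by simp)
    have hF' : ∀ x ∈ rest, IsFloat p emin x := fun x hx => hF x (List.mem_cons_of_mem _ hx)
    have hbig' : ∀ x ∈ rest, (2 : ℚ) ^ (emin + p) ≤ |x| :=
      fun x hx => hbig x (List.mem_cons_of_mem _ hx)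
    obtain ⟨hstg, hst'⟩ := uStair_cons.mp hst
    obtain ⟨hgU, hch'⟩ := List.isChain_cons.mp hch
    have hg0 : g ≠ 0 := by
      intro h; rw [h, abs_zero] at hgbig
      exact absurd hgbig (not_le.mpr (zpow_pos (by norm_num) _))
    have hulpg : ulp p emin g ≤ |g| := ulp_le_abs_of_isFloat hg hg0
    have hQleg : |Q| ≤ |g| := hQg'.trans hulpg
    obtain ⟨h1, -, -, h4⟩ := fastTwoSum_exact hp1 hfl hg inv.hQ hQleg
    -- the new carry is a faithful rounding of everything passed so far (uses the stair at `g`)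
    have hJ' : IsFaithful p emin (g + Q + rs.sum) (fastTwoSum fl g Q).1 := by
      rw [h1]; exact step_faithful hp hfl inv.hQ hgbig hg hQg' inv.sum_lt hstg
    by_cases hq : (fastTwoSum fl g Q).2 = 0
    · -- exact step
      obtain ⟨inv', hQnval, -⟩ := inv.absorb hp hfl hg hgbig hQg' hq
      rw [compressUp_cons_of_eq_zero hq] at hL
      generalize hQn : (fastTwoSum fl g Q).1 = Qn at *
      have hS : Qn + rs.sum = Q + rs.sum + g := by rw [hQnval]; ring
      have hQg_next : ∀ y ∈ rest.head?, |Qn| ≤ ulp p emin y := by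
        intro y hy
        have hgy : |g| ≤ ulp p emin y := hgU y hy
        have hT : |Qn + rs.sum| < ulp p emin y := by rw [hS]; exact hst'.head_lt hy
        obtain ⟨u, -, hU⟩ := exists_ulp_eq_two_zpow (p := p) (emin := emin) y
        obtain ⟨k, -, hK⟩ := exists_ulp_eq_two_zpow (p := p) (emin := emin) Q
        have hkQ : OnGrid k Q := by
          obtain ⟨K, hK'⟩ := exists_eq_int_mul_ulp_of_isFloat (p := p) (emin := emin) inv.hQ
          exact ⟨K, by rw [← hK]; exact hK'⟩
        have hkg : OnGrid k g := onGrid_of_two_zpow_le_ulp hg (by rw [← hK]; exact ulp_mono hQleg)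
        have hkQn : OnGrid k Qn := by rw [hQnval]; exact hkg.add hkQ
        have hku : k ≤ u := by
          have : (2 : ℚ) ^ k ≤ (2 : ℚ) ^ u := by
            rw [← hK, ← hU]; exact (ulp_mono hQleg).trans (hulpg.trans hgy)
          exact (zpow_le_zpow_iff_right₀ (by norm_num : (1 : ℚ) < 2)).mp this
        have hr : |rs.sum| < (2 : ℚ) ^ k := by rw [← hK]; exact inv.sum_lt
        rw [hU]
        exact abs_le_two_zpow_of_onGrid hku hkQn hr (by rw [← hU]; exact hT)
      have hJn : IsFaithful p emin (Qn + rs.sum) Qn := by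
        rw [hS, show Q + rs.sum + g = g + Q + rs.sum by ring]; exact hJ'
      have h := ih Qn rs inv' hJn hF' hbig' (by rw [hS]; exact hst') hch' hQg_next L hL
      rw [hS] at h
      rw [List.sum_cons, show Q + rs.sum + (g + rest.sum) = Q + rs.sum + g + rest.sum by ring]
      exact h
    · -- emitting step
      obtain ⟨inv', hbound⟩ := inv.emit hp hfl hc hflc hg hgbig hQg' hq
      rw [compressUp_cons_of_ne_zero hq, getLast?_cons_of_ne_nil (compressUp_ne_nil fl _ _)]
        at hL
      generalize hQn : (fastTwoSum fl g Q).1 = Qn at *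
      generalize hqn : (fastTwoSum fl g Q).2 = q at *
      have hS : Qn + (q :: rs).sum = Q + rs.sum + g := by rw [List.sum_cons]; linarith [h4]
      have hQg_next : ∀ y ∈ rest.head?, |Qn| ≤ ulp p emin y := by
        intro y hy
        have hgy : |g| ≤ ulp p emin y := hgU y hy
        have hT : |Qn + (q :: rs).sum| < ulp p emin y := by rw [hS]; exact hst'.head_lt hy
        obtain ⟨u, hu, hU⟩ := exists_ulp_eq_two_zpow (p := p) (emin := emin) y
        obtain ⟨k, -, hK⟩ := exists_ulp_eq_two_zpow (p := p) (emin := emin) (g + Q)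
        have hkQn : OnGrid k Qn := by
          obtain ⟨K, hK'⟩ := exists_fl_eq_int_mul_ulp hp1 hfl (g + Q)
          exact ⟨K, by rw [h1, hK', hK]⟩
        have hku : k ≤ u := by
          have ht2 : |g + Q| ≤ 2 * (2 : ℚ) ^ u :=
            calc |g + Q| ≤ |g| + |Q| := abs_add_le _ _
              _ ≤ |g| + |g| := by linarith
              _ ≤ 2 * (2 : ℚ) ^ u := by rw [← hU]; linarith
          have := ulp_le_two_zpow_of_abs_le hp hu ht2
          rw [hK] at this
          exact (zpow_le_zpow_iff_right₀ (by norm_num : (1 : ℚ) < 2)).mp this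
        have hr : |(q :: rs).sum| < (2 : ℚ) ^ k := by rw [← hK, List.sum_cons]; exact hbound
        rw [hU]
        exact abs_le_two_zpow_of_onGrid hku hkQn hr (by rw [← hU]; exact hT)
      have hJn : IsFaithful p emin (Qn + (q :: rs).sum) Qn := by
        rw [hS, show Q + rs.sum + g = g + Q + rs.sum by ring]; exact hJ'
      have h := ih Qn (q :: rs) inv' hJn hF' hbig' (by rw [hS]; exact hst') hch' hQg_next L hL
      rw [hS] at h
      rw [List.sum_cons, show Q + rs.sum + (g + rest.sum) = Q + rs.sum + g + rest.sum by ring]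
      exact h

/-- **THE TOP COMPONENT OF COMPRESS IS A FAITHFUL ROUNDING OF THE SUM** (`p ≥ 2`, ANY
round-to-nearest, every nonoverlapping expansion of floats): the last component `L` of
`compress fl e` satisfies `L ∈ {RD(Σ e), RU(Σ e)}`.  Theorem 23 only gives `|Σ e − L| < ulp L`. -/
theorem compress_top_isFaithful (hp : 2 ≤ p) (hfl : IsRoundNearest p emin fl) {e : List ℚ}
    (he : ∀ x ∈ e, IsFloat p emin x) (hexp : IsExpansion 1 e) :
    ∀ L ∈ (compress fl e).getLast?, IsFaithful p emin e.sum L := by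
  have hp1 : 1 ≤ p := le_trans (by norm_num) hp
  have hflc : RoundoffBelow 1 fl := roundoffBelow_one hp1 hfl
  cases hrev : e.reverse with
  | nil =>
    have he0 : e = [] := by simpa using congrArg List.reverse hrev
    subst he0; simp [compress]
  | cons em rest =>
    have he' : e = rest.reverse ++ [em] := by simpa using congrArg List.reverse hrev
    have hcomp : compress fl e =
        compressUp fl (compressDown fl em rest).2 (compressDown fl em rest).1.reverse := by
      simp only [compress, hrev]
    rw [hcomp]
    subst he'
    have hem : IsFloat p emin em := he em (by simp)
    have hrestF : ∀ y ∈ rest, IsFloat p emin y := fun y hy => he y (by simp [hy])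
    have hexp' : IsExpansion 1 rest.reverse := hexp.sublist (List.sublist_append_left _ _)
    have hbel : ∀ y ∈ rest, Below 1 y em := fun y hy =>
      (List.pairwise_append.mp hexp).2.2 y (List.mem_reverse.mpr hy) em (by simp)
    have outd := compressDown_spec hp hfl rest em hem hrestF hexp' hbel
    generalize (compressDown fl em rest).1 = gs at *
    generalize (compressDown fl em rest).2 = gb at *
    have inv : UpInv p emin 1 [] gb :=
      ⟨by simp, outd.hgb, List.Pairwise.nil, by simp, by simp, by simpa using ulp_pos _⟩
    have hst : UStair p emin (gb + ([] : List ℚ).sum) gs.reverse := by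
      have h := uStair_reverse_of_dStair outd.stair
      rw [List.reverse_append, List.reverse_singleton, List.singleton_append, uStair_cons,
        zero_add] at h
      simpa using h.2
    have hch0 := List.isChain_reverse.mpr outd.chain
    rw [List.reverse_append, List.reverse_singleton, List.singleton_append,
      List.isChain_cons] at hch0
    have hJ0 : IsFaithful p emin (gb + ([] : List ℚ).sum) gb := by
      rw [List.sum_nil, add_zero]; exact Or.inl (isRD_self outd.hgb)
    intro L hL
    have h := compressUp_top_isFaithful hp hfl le_rfl hflc gs.reverse gb [] inv hJ0
      (fun g hg => outd.floats g (List.mem_reverse.mp hg))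
      (fun g hg => outd.big g (List.mem_reverse.mp hg)) hst hch0.2 hch0.1 L hL
    have hsum : (rest.reverse ++ [em]).sum = gb + ([] : List ℚ).sum + gs.reverse.sum := by
      rw [List.sum_append, List.sum_singleton, List.sum_reverse, List.sum_nil, add_zero,
        List.sum_reverse]
      linarith [outd.sum_eq]
    rw [hsum]; exact h

/-- Hence `|L − Σ e| < ulp (Σ e)` (Property 2.8 of Boldo–Jeannerod–Melquiond–Muller) — never more
than Theorem 23's `ulp L`, and half of it when `Σ e` lies in the binade below `|L|`. -/
theorem abs_compress_top_sub_sum_lt_ulp (hp : 2 ≤ p) (hfl : IsRoundNearest p emin fl)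
    {e : List ℚ} (he : ∀ x ∈ e, IsFloat p emin x) (hexp : IsExpansion 1 e) :
    ∀ L ∈ (compress fl e).getLast?, |L - e.sum| < ulp p emin e.sum := fun L hL =>
  abs_sub_lt_ulp_of_isFaithful (le_trans (by norm_num) hp)
    (compress_top_isFaithful hp hfl he hexp L hL)

/-- If `Σ e` is itself a float, the top component of `COMPRESS(e)` IS `Σ e`. -/
theorem compress_top_eq_sum (hp : 2 ≤ p) (hfl : IsRoundNearest p emin fl) {e : List ℚ}
    (he : ∀ x ∈ e, IsFloat p emin x) (hexp : IsExpansion 1 e) (hS : IsFloat p emin e.sum) :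
    ∀ L ∈ (compress fl e).getLast?, L = e.sum := fun L hL =>
  (compress_top_isFaithful hp hfl he hexp L hL).eq_self hS

/-- **COMPRESS OF AN EXPANSION WITH REPRESENTABLE SUM IS THE SINGLE COMPONENT `[Σ e]`**
(`e ≠ []`): the top component is `Σ e`, so the lower components — nonzero nonoverlapping floats by
Theorem 23 — sum to zero, which forces there to be none. -/
theorem compress_eq_singleton_of_isFloat_sum (hp : 2 ≤ p) (hfl : IsRoundNearest p emin fl)
    {e : List ℚ} (he : ∀ x ∈ e, IsFloat p emin x) (hexp : IsExpansion 1 e) (hne : e ≠ [])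
    (hS : IsFloat p emin e.sum) : compress fl e = [e.sum] := by
  have out := compress_nonoverlapping hp hfl he hexp
  refine out.nz.elim (fun hnz => ?_) id
  have hcne : compress fl e ≠ [] := by
    cases hrev : e.reverse with
    | nil => exact absurd (by simpa using congrArg List.reverse hrev) hne
    | cons em rest => simp only [compress, hrev]; exact compressUp_ne_nil _ _ _
  obtain ⟨rest, L, hsplit⟩ : ∃ rest L, compress fl e = rest ++ [L] := by
    rcases List.eq_nil_or_concat (compress fl e) with h | ⟨rest, L, h⟩
    · exact absurd h hcne
    · exact ⟨rest, L, by rw [h, List.concat_eq_append]⟩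
  have hL : L = e.sum := compress_top_eq_sum hp hfl he hexp hS L (by simp [hsplit])
  have hmem : ∀ x ∈ rest, x ∈ compress fl e := fun x hx => by
    rw [hsplit]; exact List.mem_append_left _ hx
  have hrest0 : rest.sum = 0 := by
    have h := out.sum_eq
    rw [hsplit, List.sum_append, List.sum_singleton, hL] at h
    linarith
  have hexpR : IsExpansion 1 rest := by
    have h := out.exp
    rw [hsplit] at h
    exact h.sublist (List.sublist_append_left _ _)
  -- a nonoverlapping expansion of NONZERO floats with zero sum is empty
  rcases List.eq_nil_or_concat rest with hr0 | ⟨rest', t, hr⟩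
  · rw [hsplit, hr0, hL, List.nil_append]
  · exfalso
    rw [List.concat_eq_append] at hr
    rw [hr] at hrest0 hexpR hmem
    have ht0 : t ≠ 0 := hnz t (hmem t (by simp))
    have htF : IsFloat p emin t := out.floats t (hmem t (by simp))
    obtain ⟨M, v, hMo, -, -, htv⟩ := exists_odd_mul_two_zpow htF ht0
    have hM0 : M ≠ 0 := by rintro rfl; obtain ⟨m, hm⟩ := hMo; omega
    have hbelow : ∀ x ∈ rest', |x| < (2 : ℚ) ^ v := fun x hx => by
      obtain ⟨s, hs, hxs⟩ := (List.pairwise_append.mp hexpR).2.2 x hx t (by simp)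
      rw [one_mul] at hxs
      have hsv : s ≤ v := OnGrid.le_of_odd hMo (by rw [← htv]; exact hs)
      exact lt_of_lt_of_le hxs (zpow_le_zpow_right₀ (by norm_num) hsv)
    have hsum : |rest'.sum| < (2 : ℚ) ^ v :=
      abs_sum_lt_two_zpow_of_isExpansion (fun x hx => out.floats x (hmem x (by simp [hx])))
        (hexpR.sublist (List.sublist_append_left _ _)) hbelow
    have htabs : (2 : ℚ) ^ v ≤ |t| := by
      rw [htv, abs_mul, abs_of_pos (zpow_pos (by norm_num : (0 : ℚ) < 2) _)]
      have h1 : (1 : ℚ) ≤ |(M : ℚ)| := by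
        rw [← Int.cast_abs]; exact_mod_cast Int.one_le_abs hM0
      exact le_mul_of_one_le_left (zpow_pos (by norm_num) _).le h1
    rw [List.sum_append, List.sum_singleton] at hrest0
    have : |t| = |rest'.sum| := by rw [show t = -rest'.sum by linarith, abs_neg]
    linarith

end Summit.Ventures.CertifiedArithmetic.Expansions
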